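import HarnessLib
import Summits.CriticalPhenomena.CardyFormulaZ2.Theses.CardySelfRefinement
import Literature.Probability.RandomPlanarGeometry.ChordalReversibility
import Literature.Probability.LatticeModels.MedialInterfaceProofs
import Summits.CriticalPhenomena.CardyFormulaZ2.Theorems.CardySelfRefinementLagHandOffDiscretisable
import Summits.CriticalPhenomena.CardyFormulaZ2.Theorems.LagHandOff.Negative.KillTemplates

/-!
# Reversibility of the interface limit family: stub `stub_reversible` of line `SketchIdeatorTwo` for crux `SymmetryUpgradeR` (stmt-CriticalPhenomena-17239)

`stub_reversible`: a local Markov chordal family `P` which is the bond-`ℤ²` (`p = ½`) interface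
scaling limit along one mesh sequence on every admissibly discretised Dobrushin domain
(clause (iv)) is reversible, `P (D; b, a) = reverse_* P (D; a, b)` (`ChordalFamily.IsReversible`).

PROOF (bookkeeping only; no percolation estimate is consumed).

1. *Locality pins `P` on `(carrier, a, b)`.*  The restriction form of locality
   (`ChordalFamily.IsLocal`, a field of `IsLocalMarkovChordalFamily`) applied to two Dobrushin
   structures `D`, `D'` with the same carrier and the same marked points stops both curves on
   `closure (D ∖ D') = ∅`, i.e. never (`CurveClass.stopAt ∅ = id`), so `P D' = P D`
   (the tree's `LagHandOff.Negative.eq_of_isLocal_of_carrier_eq`, TEMPLATE 3 of the refuter's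
   kill templates for crux `LagHandOff`: "wiring-orientation blindness").
2. *The orientation-reversed structure.*  For `D = (Ω; a, b)` let `Dʳ` be the Dobrushin structure
   with the boundary loop traversed backwards, `t ↦ ∂D (mark 0 + mark 1 − t)`, and the same marks:
   same carrier, `Dʳ.pt 0 = b`, `Dʳ.pt 1 = a`, and the SAME two boundary arcs as sets,
   `Dʳ.arc 0 = D.arc 0 = (ab)`, `Dʳ.arc 1 = D.arc 1 = (ba)` (`stub_reversible_exists_reversed`).
   Hence every admissible `ℤ²`-discretisation family `E` of `D` (one exists: `stub_discretisable`,
   crux `LagHandOff`) is an admissible family of `Dʳ` (`ZdDiscretisationFamily` sees `D` only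
   through the carrier, the two arcs and the set `{a, b}`).
3. *Exact lattice identity.*  `bondInterfaceIn D E ω = CurveClass.mk (orientCurve D c)` re-orients
   the medial exploration polyline `c` of the data `E` by the endpoint rule (start at the mark
   nearest to `c 0`); `Dʳ` has the marks exchanged, so `bondInterfaceIn Dʳ E ω` is LITERALLY the
   time reversal of `bondInterfaceIn D E ω` whenever `c 0` is not equidistant from `a` and `b`
   (`stub_reversible_bondInterfaceIn_eq_reverse`).  For an admissible family this holds for all
   small `δ` and all `ω` at once: the exploration of admissible data is genuine
   (`isMedialExploration_medialExploration_holds`), it starts at the midpoint of an `A`–`B` edge,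
   and these midpoints are within `|a − b| / 2` of `{a, b}` eventually (`tendsto_zdABEdges`)
   (`stub_reversible_eventually_eq_reverse`).
4. *Passage to the limit.*  Along the mesh sequence of clause (iv), for `f` bounded continuous,
   `∫ f (bondInterfaceIn Dʳ (E δₙ)) = ∫ (f ∘ reverse) (bondInterfaceIn D (E δₙ))` eventually; the
   left side tends to `∫ f d(P Dʳ)` and the right side to `∫ f ∘ reverse d(P D)` (clause (iv) for
   `(Dʳ, E)` and for `(D, E)`), so `P Dʳ = reverse_* (P D)` (bounded continuous functions separate
   finite Borel measures on the metric space `CurveClass ℂ`) (`stub_reversible_map_reverse`).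
5. For arbitrary `D'` on the carrier of `D` with the marks exchanged, `P D' = P Dʳ` by step 1.

Remark (for the record of the line).  In the tree's rendering the swap `a ↔ b` is not realised by
the swapped DATA `E.swap` (wired and dual-wired arcs exchanged), whose interfaces are not lattice
reversals of those of `E`; it is realised by the swapped DOMAIN STRUCTURE `Dʳ` with the SAME data,
for which the reversal is exact.  The wired/dual-wired exchange symmetry of the limit is then a
consequence of the hypotheses (clause (iv) at `D.swap` with `E.swap` and at `Dʳ` with `E`, plus
step 1), not an input of this proof.
-/

noncomputable section

namespace Summit.CriticalPhenomena.CardyFormulaZ2.Theorems.SymmetryUpgradeR.SwallowingSkeleton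

open MeasureTheory Filter Set
open Literature.Probability.RandomPlanarGeometry Literature.Probability.LatticeModels
  Literature.Probability.Percolation
open scoped unitInterval ENNReal Topology

/-! ### Step 2: the orientation-reversed Dobrushin structure -/

/-- Image of an interval under a map precomposed with `t ↦ c - t`. [folklore] -/
theorem stub_reversible_image_const_sub (g : ℝ → ℂ) (c u v : ℝ) :
    (fun t => g (c - t)) '' Icc u v = g '' Icc (c - v) (c - u) := by
  rw [← image_const_sub_Icc, image_image]

-- injectivity argument adapted from `Function.Periodic.injOn_shift`
-- (Literature/Probability/RandomPlanarGeometry/ArcHullDomains.lean)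
/-- **The orientation-reversed Dobrushin structure.** Every Dobrushin domain `(D; a, b)` has a
companion structure on the same carrier with the boundary loop traversed backwards
(`t ↦ ∂D (mark 0 + mark 1 − t)`, same marks): its marked points are `b, a` (exchanged) and its two
boundary arcs are those of `D` as sets (`arc 0 = (ab)`, `arc 1 = (ba)`). [folklore] -/
theorem stub_reversible_exists_reversed (D : DobrushinDomain) :
    ∃ D' : DobrushinDomain, D'.carrier = D.carrier ∧ D'.pt 0 = D.pt 1 ∧ D'.pt 1 = D.pt 0 ∧
      D'.arc 0 = D.arc 0 ∧ D'.arc 1 = D.arc 1 := by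
  set c : ℝ := D.mark 0 + D.mark 1 with hcdef
  have hfract : ∀ x : ℝ, D.boundary (Int.fract x) = D.boundary x := fun x => by
    rw [Int.fract]
    have := D.periodic_boundary.sub_int_mul_eq (x := x) ⌊x⌋
    rwa [mul_one] at this
  have hinj : InjOn (fun t : ℝ => D.boundary (c - t)) (Ico 0 1) := by
    intro s hs t ht hst
    simp only at hst
    rw [← hfract (c - s), ← hfract (c - t)] at hst
    have h1 := D.injOn_boundary ⟨Int.fract_nonneg _, Int.fract_lt_one _⟩
      ⟨Int.fract_nonneg _, Int.fract_lt_one _⟩ hst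
    obtain ⟨z, hz⟩ := Int.fract_eq_fract.1 h1
    have hz' : (t - s : ℝ) = z := by linarith
    have habs : |(z : ℝ)| < 1 := by
      rw [← hz', abs_sub_lt_iff]
      exact ⟨by linarith [hs.1, hs.2, ht.1, ht.2], by linarith [hs.1, hs.2, ht.1, ht.2]⟩
    have hz0 : z = 0 := by
      have : |z| < 1 := by exact_mod_cast habs
      exact Int.abs_lt_one_iff.1 this
    rw [hz0, Int.cast_zero, sub_eq_zero] at hz'
    exact hz'.symm
  let D' : DobrushinDomain :=
    { carrier := D.carrier
      boundary := fun t => D.boundary (c - t)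
      isOpen := D.isOpen
      isBounded := D.isBounded
      isConnected := D.isConnected
      continuous_boundary := D.continuous_boundary.comp (continuous_const.sub continuous_id)
      periodic_boundary := fun t => by
        show D.boundary (c - (t + 1)) = D.boundary (c - t)
        rw [show c - (t + 1) = c - t - 1 by ring]
        exact D.periodic_boundary.sub_eq (c - t)
      injOn_boundary := hinj
      range_boundary := by
        have hs : Function.Surjective fun t : ℝ => c - t := fun t => ⟨c - t, sub_sub_cancel c t⟩
        rw [show (fun t => D.boundary (c - t)) = D.boundary ∘ fun t => c - t from rfl,
          hs.range_comp]
        exact D.range_boundary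
      mark := D.mark
      strictMono_mark := D.strictMono_mark
      mark_mem := D.mark_mem }
  have hc0 : c - D.mark 0 = D.mark 1 := by rw [hcdef]; ring
  have hc1 : c - D.mark 1 = D.mark 0 := by rw [hcdef]; ring
  have hc01 : c - (D.mark 0 + 1) = D.mark 1 - 1 := by rw [hcdef]; ring
  have hIcc : Icc (D.mark 1) (D.mark 0 + 1) = (fun x => x + 1) '' Icc (D.mark 1 - 1) (D.mark 0) := by
    rw [image_add_const_Icc, sub_add_cancel]
  refine ⟨D', rfl, ?_, ?_, ?_, ?_⟩
  · show D.boundary (c - D.mark 0) = D.boundary (D.mark 1)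
    rw [hc0]
  · show D.boundary (c - D.mark 1) = D.boundary (D.mark 0)
    rw [hc1]
  · show (fun t => D.boundary (c - t)) '' Icc (D.mark 0) (D'.nextMark 0) =
      D.boundary '' Icc (D.mark 0) (D.nextMark 0)
    rw [MarkedDomain.nextMark_zero_two, MarkedDomain.nextMark_zero_two,
      stub_reversible_image_const_sub]
    show D.boundary '' Icc (c - D.mark 1) (c - D.mark 0) = D.boundary '' Icc (D.mark 0) (D.mark 1)
    rw [hc1, hc0]
  · show (fun t => D.boundary (c - t)) '' Icc (D.mark 1) (D'.nextMark 1) =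
      D.boundary '' Icc (D.mark 1) (D.nextMark 1)
    rw [MarkedDomain.nextMark_one_two, MarkedDomain.nextMark_one_two,
      stub_reversible_image_const_sub]
    show D.boundary '' Icc (c - (D.mark 0 + 1)) (c - D.mark 1) =
      D.boundary '' Icc (D.mark 1) (D.mark 0 + 1)
    rw [hc01, hc1, hIcc, image_image]
    exact image_congr fun t _ => (D.periodic_boundary t).symm

/-- A `ℤ²`-discretisation family of `(D; a, b)` is one of every Dobrushin structure with the same
carrier, the same two boundary arcs (as sets) and the same set of marked points — in particular of
the orientation-reversed structure `(D; b, a)` of `stub_reversible_exists_reversed`.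
(CDHKS 2014, §1, for the notion.) [folklore] -/
theorem stub_reversible_zdDiscretisationFamily_congr {D D' : DobrushinDomain}
    {E : ℝ → DiscreteDobrushin} (hE : ZdDiscretisationFamily D E) (hc : D'.carrier = D.carrier)
    (hpt : ({D'.pt 0, D'.pt 1} : Set ℂ) = {D.pt 0, D.pt 1}) (ha0 : D'.arc 0 = D.arc 0)
    (ha1 : D'.arc 1 = D.arc 1) : ZdDiscretisationFamily D' E where
  Ω_eq δ := by rw [hE.Ω_eq, hc]
  δ_eq := hE.δ_eq
  tendsto_arcA := by rw [ha0]; exact hE.tendsto_arcA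
  tendsto_arcB := by rw [ha1]; exact hE.tendsto_arcB
  tendsto_zdABEdges := by rw [hpt]; exact hE.tendsto_zdABEdges
  eventually_isZdAdmissible := hE.eventually_isZdAdmissible

/-! ### Step 3: the exact lattice identity -/

/-- **Exchanging the marks reverses the interface (exact lattice identity).** For two Dobrushin
structures `D = (Ω; a, b)` and `D' = (Ω'; b, a)` with the marked points exchanged, the SAME
discrete data `E` and the SAME configuration `ω`, the interface re-oriented for `D'` is the time
reversal of the interface re-oriented for `D`, provided the starting point of the exploration
polyline is not equidistant from `a` and `b` (the endpoint rule `orientCurve` compares these two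
distances). [folklore] -/
theorem stub_reversible_bondInterfaceIn_eq_reverse {D D' : DobrushinDomain}
    (h0 : D'.pt 0 = D.pt 1) (h1 : D'.pt 1 = D.pt 0) (E : DiscreteDobrushin)
    (ω : BondConfig (Site 2))
    (hne : dist (medialExplorationCurve E ω 0) (D.pt 0) ≠
      dist (medialExplorationCurve E ω 0) (D.pt 1)) :
    bondInterfaceIn D' E ω = (bondInterfaceIn D E ω).reverse := by
  rw [bondInterfaceIn_apply, bondInterfaceIn_apply]
  rcases lt_or_gt_of_ne hne with h | h
  · rw [orientCurve_of_le D h.le, orientCurve_of_lt D' (by rwa [h0, h1]), CurveClass.reverse_mk]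
    rfl
  · rw [orientCurve_of_lt D h, orientCurve_of_le D' (by rw [h0, h1]; exact h.le),
      CurveClass.reverse_mk]
    show CurveClass.mk ⟨medialExplorationCurve E ω⟩ =
      CurveClass.mk ⟨reverseCurve (reverseCurve (medialExplorationCurve E ω))⟩
    rw [reverseCurve_reverseCurve]

/-- The head of a list known to be a `cons`. [folklore] -/
theorem stub_reversible_head_eq {α : Type*} {m : List α} (hm : m ≠ []) {e : α} {l : List α}
    (h : m = e :: l) : m.head hm = e := by
  subst h
  rfl

/-- **Eventual pathwise reversal along an admissible family.** For an admissible
`ℤ²`-discretisation family `E` of `(D; a, b)` and a structure `D'` with the marks exchanged, for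
all small meshes `δ` and ALL configurations `ω`,
`bondInterfaceIn D' (E δ) ω = (bondInterfaceIn D (E δ) ω).reverse`: the exploration of admissible
data is genuine (`isMedialExploration_medialExploration_holds`) and starts at the midpoint of an
`A`–`B` edge, which lies within `|a − b| / 2` of `{a, b}` eventually (`tendsto_zdABEdges`), hence
is not equidistant from `a` and `b`. [folklore] -/
theorem stub_reversible_eventually_eq_reverse {D D' : DobrushinDomain} {E : ℝ → DiscreteDobrushin}
    (hE : ZdDiscretisationFamily D E) (h0 : D'.pt 0 = D.pt 1) (h1 : D'.pt 1 = D.pt 0) :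
    ∀ᶠ δ in 𝓝[>] (0 : ℝ), ∀ ω, bondInterfaceIn D' (E δ) ω = (bondInterfaceIn D (E δ) ω).reverse := by
  have hab : 0 < dist (D.pt 0) (D.pt 1) :=
    dist_pos.2 fun h => absurd (D.pt_injective h) (by decide)
  set r : ℝ := dist (D.pt 0) (D.pt 1) / 2 with hr
  have hr0 : (0 : ℝ≥0∞) < ENNReal.ofReal r := ENNReal.ofReal_pos.2 (by positivity)
  have hlt : ∀ᶠ δ in 𝓝[>] (0 : ℝ),
      Metric.hausdorffEDist (medialPoint δ '' (E δ).zdABEdges) {D.pt 0, D.pt 1} <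
        ENNReal.ofReal r :=
    hE.tendsto_zdABEdges.eventually (eventually_lt_nhds hr0)
  filter_upwards [hE.eventually_isZdAdmissible, hlt] with δ hadm hδ ω
  apply stub_reversible_bondInterfaceIn_eq_reverse h0 h1
  have hγ := isMedialExploration_medialExploration_holds (E δ) hadm ω
  obtain ⟨e, l, hel⟩ := List.exists_cons_of_ne_nil hγ.ne_nil
  have hhead : e ∈ (E δ).zdABEdges := by
    have := hγ.head_mem
    rwa [stub_reversible_head_eq hγ.ne_nil hel] at this
  have hp : medialExplorationCurve (E δ) ω 0 = medialPoint δ e := by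
    show polyline ((medialExploration (E δ) ω).map (medialPoint (E δ).δ)) 0 = _
    rw [hel, List.map_cons, polyline_apply_zero, hE.δ_eq]
  have hmem : medialExplorationCurve (E δ) ω 0 ∈ medialPoint δ '' (E δ).zdABEdges :=
    hp ▸ mem_image_of_mem _ hhead
  obtain ⟨y, hy, hy'⟩ := Metric.exists_edist_lt_of_hausdorffEDist_lt hmem hδ
  rw [edist_lt_ofReal] at hy'
  have htri := dist_triangle_left (D.pt 0) (D.pt 1) (medialExplorationCurve (E δ) ω 0)
  simp only [mem_insert_iff, mem_singleton_iff] at hy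
  intro heq
  rcases hy with rfl | rfl
  · linarith
  · linarith

/-! ### Step 4: passage to the limit along the mesh sequence -/

open Cruxes.LagHandOff.HittingTournament (stub_discretisable) in
/-- **Reversal in the limit.** Under clause (iv) along a mesh sequence `δₙ → 0⁺`, for a chordal
family `P` and a Dobrushin structure `D'` on the carrier of `D` with the marks exchanged and the
same boundary arcs as sets, `P D' = reverse_* (P D)`: with an admissible family `E` of `D`
(`stub_discretisable`), also admissible for `D'`, the integrals
`∫ f (bondInterfaceIn D' (E δₙ))` and `∫ (f ∘ reverse) (bondInterfaceIn D (E δₙ))` agree eventually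
(`stub_reversible_eventually_eq_reverse`) and converge to `∫ f d(P D')`, resp.
`∫ f d(reverse_* P D)`; bounded continuous functions separate finite Borel measures. [folklore] -/
theorem stub_reversible_map_reverse {P : ChordalFamily} (hC : P.IsChordal) {δs : ℕ → ℝ}
    (hpos : ∀ n, 0 < δs n) (hδ : Tendsto δs atTop (𝓝 0))
    (hconv : ∀ (D : DobrushinDomain) (E : ℝ → DiscreteDobrushin), ZdDiscretisationFamily D E →
      ∀ f : BoundedContinuousFunction (CurveClass ℂ) ℝ,
        Tendsto (fun n => ∫ ω, f (bondInterfaceIn D (E (δs n)) ω) ∂(bondPercolation (zdGraph 2) half))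
          atTop (𝓝 (∫ γ, f γ ∂(P D))))
    {D D' : DobrushinDomain} (hc : D'.carrier = D.carrier) (h0 : D'.pt 0 = D.pt 1)
    (h1 : D'.pt 1 = D.pt 0) (ha0 : D'.arc 0 = D.arc 0) (ha1 : D'.arc 1 = D.arc 1) :
    P D' = (P D).map CurveClass.reverse := by
  obtain ⟨E, hE⟩ := stub_discretisable D
  have hE' : ZdDiscretisationFamily D' E :=
    stub_reversible_zdDiscretisationFamily_congr hE hc (by rw [h0, h1, pair_comm]) ha0 ha1
  have htend : Tendsto δs atTop (𝓝[>] 0) :=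
    tendsto_nhdsWithin_iff.2 ⟨hδ, Eventually.of_forall hpos⟩
  have hev : ∀ᶠ n in atTop, ∀ ω,
      bondInterfaceIn D' (E (δs n)) ω = (bondInterfaceIn D (E (δs n)) ω).reverse :=
    htend.eventually (stub_reversible_eventually_eq_reverse hE h0 h1)
  haveI : IsProbabilityMeasure (P D) := (hC D).1
  haveI : IsProbabilityMeasure (P D') := (hC D').1
  refine ext_of_forall_integral_eq_of_IsFiniteMeasure fun f => ?_
  set g : BoundedContinuousFunction (CurveClass ℂ) ℝ :=
    f.compContinuous ⟨CurveClass.reverse, CurveClass.continuous_reverse⟩ with hg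
  have hlim₁ := hconv D' E hE' f
  have hlim₂ : Tendsto
      (fun n => ∫ ω, f (bondInterfaceIn D' (E (δs n)) ω) ∂(bondPercolation (zdGraph 2) half))
      atTop (𝓝 (∫ γ, g γ ∂(P D))) := by
    refine (hconv D E hE g).congr' ?_
    filter_upwards [hev] with n hn
    simp only [hn, hg, BoundedContinuousFunction.compContinuous_apply, ContinuousMap.coe_mk]
  rw [tendsto_nhds_unique hlim₁ hlim₂,
    integral_map CurveClass.measurable_reverse.aemeasurable
      f.continuous.stronglyMeasurable.aestronglyMeasurable]
  simp [hg]

/-! ### The registered stub -/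

/-- **Registered stub `stub_reversible`** (S2 · FL1 of line `SketchIdeatorTwo`, crux
`SymmetryUpgradeR`): a local Markov chordal family which is the bond-`ℤ²` (`p = ½`) interface
scaling limit along one mesh sequence on every admissibly discretised Dobrushin domain
(clause (iv)) is reversible.  Locality pins `P` on `(carrier, a, b)`
(`LagHandOff.Negative.eq_of_isLocal_of_carrier_eq`); the orientation-reversed structure `(D; b, a)` with
the same arcs (`stub_reversible_exists_reversed`) carries the same admissible families, on which
the re-oriented interface is the exact lattice reversal (`stub_reversible_eventually_eq_reverse`),
and clause (iv) passes the identity to the limit (`stub_reversible_map_reverse`).  The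
non-tracing clause and the measurability clause (iii) are not used. [folklore] -/
theorem stub_reversible : ∀ P : ChordalFamily, IsLocalMarkovChordalFamily P → (∀ D : DobrushinDomain, ∀ᵐ γ ∂(P D), ∀ c : Curve ℂ, CurveClass.mk c = γ → ∀ s t : unitInterval, s < t → c '' Set.Icc s t ⊆ frontier D.carrier → (c '' Set.Icc s t).Subsingleton) → ((∀ (D : DobrushinDomain) (E : ℝ → DiscreteDobrushin), ZdDiscretisationFamily D E → ∀ᶠ δ in nhdsWithin (0 : ℝ) (Set.Ioi 0), AEMeasurable (bondInterfaceIn D (E δ)) (bondPercolation (zdGraph 2) half)) ∧ ∃ δs : ℕ → ℝ, (∀ n, 0 < δs n) ∧ Tendsto δs atTop (nhds 0) ∧ ∀ (D : DobrushinDomain) (E : ℝ → DiscreteDobrushin), ZdDiscretisationFamily D E → ∀ f : BoundedContinuousFunction (CurveClass ℂ) ℝ, Tendsto (fun n => ∫ ω, f (bondInterfaceIn D (E (δs n)) ω) ∂(bondPercolation (zdGraph 2) half)) atTop (nhds (∫ γ, f γ ∂(P D)))) → P.IsReversible := by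
  intro P hP _hnt hIV
  obtain ⟨-, δs, hpos, hδ, hconv⟩ := hIV
  intro D D' hc h0 h1
  obtain ⟨Dr, hcr, h0r, h1r, ha0, ha1⟩ := stub_reversible_exists_reversed D
  rw [LagHandOff.Negative.eq_of_isLocal_of_carrier_eq hP.isLocal (D := Dr) (D' := D')
    (hc.trans hcr.symm) (h0.trans h0r.symm) (h1.trans h1r.symm)]
  exact stub_reversible_map_reverse hP.isChordal hpos hδ hconv hcr h0r h1r ha0 ha1

end Summit.CriticalPhenomena.CardyFormulaZ2.Theorems.SymmetryUpgradeR.SwallowingSkeleton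

end
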